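import Mathlib.LinearAlgebra.TensorProduct.RightExactness
import Mathlib.LinearAlgebra.Matrix.Kronecker
import Literature.Algebra.Module.IdempotentMatrixFixedTensor
import HarnessLib

/-!
# The Kronecker presentation: `E·Rᵐ ⊗_R F·Rⁿ ≅ (reindex (E ⊗ₖ F))·R^{m·n}` for idempotent matrices

Topic `Algebra/Module`, namespace `Literature.Algebra.Module.IdempotentMatrix` (pure commutative algebra over a commutative ring `R`;
constructions with bodies + proved theorems; no named fact, no `sorry`, no `instance`, no notation).  Cell `hodgecm-mathlib`, F0/P6 «MOD»,
P6a organ (g2) MODULE-SIDE companion of ★ `AlgebraicGeometry/AbelianSchemes/SerreTensorComposition` (whose `kronPres E F` is by definition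
`Matrix.reindex finProdFinEquiv finProdFinEquiv (F ⊗ₖ E)`); `--supports stmt-HodgeConjecture-24832`, count-neutral.  HC_CM is proved only
modulo the 2 remaining named inputs (hLiu418, h413) until rung 0 closes; this file discharges none of them.

## Mathematics

Let `F ∈ Mₘ(R)`, `E ∈ Mₙ(R)` be idempotent, presenting the finite projective modules `𝔟 = F·Rᵐ = range F`, `𝔞 = E·Rⁿ = range E`.  Under
the identification `Rᵐ ⊗ Rⁿ ≅ R^{m·n}` (`u ⊗ v ↦ (u_i v_k)_{(i,k)}`, pairs ordered by `finProdFinEquiv : Fin m × Fin n ≃ Fin (m·n)`) the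
endomorphism `F ⊗ E` becomes the reindexed Kronecker matrix `G = reindex (F ⊗ₖ E)`, `G_{(i,k),(j,k')} = F_{ij} E_{kk'}`; since the inclusions
`𝔟 ↪ Rᵐ`, `𝔞 ↪ Rⁿ` are SPLIT (by `f ↦ Ff`, `f ↦ Ef`), `𝔟 ⊗ 𝔞 ↪ Rᵐ ⊗ Rⁿ` is injective with image `range (F ⊗ E)`, whence
`𝔟 ⊗_R 𝔞 ≅ range G = G·R^{m·n}`: the Kronecker matrix presents the tensor product (B. Conrad, *Gross–Zagier revisited* §7, where
`(M ⊗ N) ⊗_𝒪 A ≅ M ⊗_𝒪 (N ⊗_𝒪 A)` is used; this is its module-side bookkeeping on presentations).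

## Contents

* §1 `sum_fin_mul_eq`, `piTensorPiEquiv m n : (Fin m → R) ⊗[R] (Fin n → R) ≃ₗ[R] (Fin (m*n) → R)` with `piTensorPiEquiv_tmul`
  (`u ⊗ v ↦ (i,k) ↦ u i * v k`), `reindex_kronecker_apply`, **`piTensorPiEquiv_map`** (`Φ ∘ (F ⊗ E) = G ∘ Φ`);
* §2 `map_subtype_injective` (split inclusions stay injective after `⊗`), `rangeProj_surjective`, `range_map_subtype`, `rangeTensorRangeEquiv`,
  **`rangeKronEquiv F hF E hE : range (toLin' F) ⊗[R] range (toLin' E) ≃ₗ[R] range (toLin' (reindex finProdFinEquiv finProdFinEquiv (F ⊗ₖ E)))`**,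
  `rangeKronEquiv_tmul_coe` (`f ⊗ g ↦ (f_i g_k)_{(i,k)}`).

## References
* [Conrad2004GrossZagier] B. Conrad, *Gross–Zagier revisited*, MSRI Publ. 49 (2004), §7.
* [Bourbaki1989CommAlg] N. Bourbaki, *Commutative Algebra*, Ch. II §5.2.
* Tree: ★ `Algebra/Module/IdempotentMatrixFixedTensor` (`rangeProj`, `rangeProj_comp_subtype`, `subtype_comp_rangeProj`).
-/

noncomputable section

namespace Literature.Algebra.Module.IdempotentMatrix

open Matrix TensorProduct
open scoped TensorProduct Kronecker

variable {R : Type*} [CommRing R]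

/-! ## §1 `Rᵐ ⊗ Rⁿ ≅ R^{m·n}` and the Kronecker matrix -/

section Pi

variable (m n : ℕ)

/-- `∑_{l < m·n} f l = ∑_i ∑_k f (i,k)`. [cite: Conrad2004GrossZagier, §7] -/
theorem sum_fin_mul_eq {M : Type*} [AddCommMonoid M] (f : Fin (m * n) → M) :
    ∑ l, f l = ∑ i : Fin m, ∑ k : Fin n, f (finProdFinEquiv (i, k)) := by
  rw [← Fintype.sum_prod_type', ← Fintype.sum_equiv finProdFinEquiv (fun p => f (finProdFinEquiv p)) f (fun _ => rfl)]

/-- **`Rᵐ ⊗_R Rⁿ ≃ₗ R^{m·n}`**, `u ⊗ v ↦ ((i,k) ↦ u_i v_k)` (index pairs ordered by `finProdFinEquiv`). [cite: Conrad2004GrossZagier, §7] -/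
def piTensorPiEquiv : (Fin m → R) ⊗[R] (Fin n → R) ≃ₗ[R] (Fin (m * n) → R) :=
  (TensorProduct.piScalarRight R R (Fin m → R) (Fin n)).trans
    ((LinearEquiv.curry R R (Fin n) (Fin m)).symm.trans
      (LinearEquiv.funCongrLeft R R (finProdFinEquiv.symm.trans (Equiv.prodComm (Fin m) (Fin n)))))

/-- `Φ (u ⊗ v) (i,k) = u_i v_k`. [cite: Conrad2004GrossZagier, §7] -/
@[simp] theorem piTensorPiEquiv_tmul (u : Fin m → R) (v : Fin n → R) (i : Fin m) (k : Fin n) :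
    piTensorPiEquiv m n (u ⊗ₜ v) (finProdFinEquiv (i, k)) = u i * v k := by
  simp [piTensorPiEquiv, LinearEquiv.funCongrLeft_apply, LinearMap.funLeft_apply, LinearEquiv.coe_curry_symm,
    TensorProduct.piScalarRight_apply, TensorProduct.piScalarRightHom_tmul, mul_comm]

variable {m n}

/-- Entries of the reindexed Kronecker matrix: `G_{(i,k),(j,k')} = F_{ij} E_{kk'}`. [cite: Conrad2004GrossZagier, §7] -/
@[simp] theorem reindex_kronecker_apply (F : Matrix (Fin m) (Fin m) R) (E : Matrix (Fin n) (Fin n) R) (i j : Fin m) (k k' : Fin n) :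
    Matrix.reindex finProdFinEquiv finProdFinEquiv (F ⊗ₖ E) (finProdFinEquiv (i, k)) (finProdFinEquiv (j, k')) = F i j * E k k' := by
  simp [Matrix.reindex_apply, Matrix.submatrix_apply, Matrix.kroneckerMap_apply]

/-- **`Φ ∘ (F ⊗ E) = G ∘ Φ`**: under `Rᵐ ⊗ Rⁿ ≅ R^{m·n}` the map `F ⊗ E` is the reindexed Kronecker matrix. [cite: Conrad2004GrossZagier, §7] -/
theorem piTensorPiEquiv_map (F : Matrix (Fin m) (Fin m) R) (E : Matrix (Fin n) (Fin n) R) (x : (Fin m → R) ⊗[R] (Fin n → R)) :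
    piTensorPiEquiv m n (TensorProduct.map (Matrix.toLin' F) (Matrix.toLin' E) x) =
      Matrix.toLin' (Matrix.reindex finProdFinEquiv finProdFinEquiv (F ⊗ₖ E)) (piTensorPiEquiv m n x) := by
  induction x using TensorProduct.induction_on with
  | zero => simp only [map_zero]
  | tmul u v =>
    funext l
    obtain ⟨⟨i, k⟩, rfl⟩ := finProdFinEquiv.surjective l
    rw [TensorProduct.map_tmul, piTensorPiEquiv_tmul, Matrix.toLin'_apply, Matrix.toLin'_apply, Matrix.toLin'_apply, Matrix.mulVec,
      Matrix.mulVec, Matrix.mulVec, dotProduct, dotProduct, dotProduct, sum_fin_mul_eq, Finset.sum_mul_sum]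
    refine Finset.sum_congr rfl fun j _ => Finset.sum_congr rfl fun k' _ => ?_
    rw [reindex_kronecker_apply, piTensorPiEquiv_tmul]
    ring
  | add x y hx hy => simp only [map_add, hx, hy]

/-- The same as an identity of linear maps. [cite: Conrad2004GrossZagier, §7] -/
theorem piTensorPiEquiv_comp_map (F : Matrix (Fin m) (Fin m) R) (E : Matrix (Fin n) (Fin n) R) :
    (piTensorPiEquiv m n).toLinearMap ∘ₗ TensorProduct.map (Matrix.toLin' F) (Matrix.toLin' E) =
      Matrix.toLin' (Matrix.reindex finProdFinEquiv finProdFinEquiv (F ⊗ₖ E)) ∘ₗ (piTensorPiEquiv m n).toLinearMap :=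
  LinearMap.ext fun x => piTensorPiEquiv_map F E x

end Pi

/-! ## §2 `range F ⊗ range E ≅ range G` -/

section Range

variable {m n : ℕ} (F : Matrix (Fin m) (Fin m) R) (hF : F * F = F) (E : Matrix (Fin n) (Fin n) R) (hE : E * E = E)

include hF hE in
/-- Split inclusions stay injective after tensoring: `ι_F ⊗ ι_E : range F ⊗ range E → Rᵐ ⊗ Rⁿ` is injective (retraction `π_F ⊗ π_E`).
[cite: Conrad2004GrossZagier, §7] -/
theorem map_subtype_injective :
    Function.Injective (TensorProduct.map (LinearMap.range (Matrix.toLin' F)).subtype (LinearMap.range (Matrix.toLin' E)).subtype) := by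
  intro x y hxy
  have h := congrArg (TensorProduct.map (rangeProj F) (rangeProj E)) hxy
  rwa [← LinearMap.comp_apply, ← LinearMap.comp_apply, ← TensorProduct.map_comp, rangeProj_comp_subtype hF,
    rangeProj_comp_subtype hE, TensorProduct.map_id, LinearMap.id_apply, LinearMap.id_apply] at h

/-- The projection `Rⁿ → range E`, `f ↦ Ef`, is surjective. [cite: Conrad2004GrossZagier, §7] -/
theorem rangeProj_surjective : Function.Surjective (rangeProj E) := LinearMap.surjective_rangeRestrict _

/-- `range (ι_F ⊗ ι_E) = range (F ⊗ E)` (`F = ι_F π_F` with `π_F` surjective). [cite: Conrad2004GrossZagier, §7] -/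
theorem range_map_subtype :
    LinearMap.range (TensorProduct.map (LinearMap.range (Matrix.toLin' F)).subtype (LinearMap.range (Matrix.toLin' E)).subtype) =
      LinearMap.range (TensorProduct.map (Matrix.toLin' F) (Matrix.toLin' E)) := by
  have h : TensorProduct.map (Matrix.toLin' F) (Matrix.toLin' E) =
      TensorProduct.map (LinearMap.range (Matrix.toLin' F)).subtype (LinearMap.range (Matrix.toLin' E)).subtype ∘ₗ
        TensorProduct.map (rangeProj F) (rangeProj E) := by
    rw [← TensorProduct.map_comp, subtype_comp_rangeProj, subtype_comp_rangeProj]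
  rw [h, LinearMap.range_comp_of_range_eq_top _ (LinearMap.range_eq_top.mpr
    (TensorProduct.map_surjective (rangeProj_surjective F) (rangeProj_surjective E)))]

/-- `range F ⊗ range E ≃ₗ range (F ⊗ E) ⊆ Rᵐ ⊗ Rⁿ`. [cite: Conrad2004GrossZagier, §7] -/
def rangeTensorRangeEquiv :
    LinearMap.range (Matrix.toLin' F) ⊗[R] LinearMap.range (Matrix.toLin' E) ≃ₗ[R]
      LinearMap.range (TensorProduct.map (Matrix.toLin' F) (Matrix.toLin' E)) :=
  (LinearEquiv.ofInjective _ (map_subtype_injective F hF E hE)).trans (LinearEquiv.ofEq _ _ (range_map_subtype F E))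

/-- `range G = Φ (range (F ⊗ E))`. [cite: Conrad2004GrossZagier, §7] -/
theorem range_toLin'_reindex_kronecker :
    LinearMap.range (Matrix.toLin' (Matrix.reindex finProdFinEquiv finProdFinEquiv (F ⊗ₖ E))) =
      (LinearMap.range (TensorProduct.map (Matrix.toLin' F) (Matrix.toLin' E))).map (piTensorPiEquiv m n).toLinearMap := by
  rw [← LinearMap.range_comp, piTensorPiEquiv_comp_map, LinearMap.range_comp_of_range_eq_top _ (LinearEquiv.range _)]

/-- **`𝔟 ⊗_R 𝔞 ≃ₗ G·R^{m·n}`**: the reindexed Kronecker matrix `G = reindex (F ⊗ₖ E)` presents `range F ⊗ range E`.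
[cite: Conrad2004GrossZagier, §7] -/
def rangeKronEquiv :
    LinearMap.range (Matrix.toLin' F) ⊗[R] LinearMap.range (Matrix.toLin' E) ≃ₗ[R]
      LinearMap.range (Matrix.toLin' (Matrix.reindex finProdFinEquiv finProdFinEquiv (F ⊗ₖ E))) :=
  (rangeTensorRangeEquiv F hF E hE).trans
    ((LinearEquiv.submoduleMap (piTensorPiEquiv m n) _).trans (LinearEquiv.ofEq _ _ (range_toLin'_reindex_kronecker F E).symm))

/-- On pure tensors: `rangeKronEquiv (f ⊗ g) = ((i,k) ↦ f_i g_k)`. [cite: Conrad2004GrossZagier, §7] -/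
theorem rangeKronEquiv_tmul_coe (f : LinearMap.range (Matrix.toLin' F)) (g : LinearMap.range (Matrix.toLin' E)) (i : Fin m) (k : Fin n) :
    (rangeKronEquiv F hF E hE (f ⊗ₜ g) : Fin (m * n) → R) (finProdFinEquiv (i, k)) = (f : Fin m → R) i * (g : Fin n → R) k := by
  change piTensorPiEquiv m n (TensorProduct.map (LinearMap.range (Matrix.toLin' F)).subtype (LinearMap.range (Matrix.toLin' E)).subtype
    (f ⊗ₜ g)) (finProdFinEquiv (i, k)) = _
  rw [TensorProduct.map_tmul, Submodule.subtype_apply, Submodule.subtype_apply, piTensorPiEquiv_tmul]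

end Range

end Literature.Algebra.Module.IdempotentMatrix

end
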